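import Mathlib
import Summits.ValiantsHypothesis.ValiantsHypothesis.Theorems.RigidityForcesSymmetryRankRigidMinimalReprLaplaceFiveSectorSplitDefs
import Summits.ValiantsHypothesis.ValiantsHypothesis.Theorems.RigidityForcesSymmetryRankRigidMinimalReprLaplaceFiveSumRigidK4eIdentsB
import Summits.ValiantsHypothesis.ValiantsHypothesis.Theorems.RigidityForcesSymmetryRankRigidMinimalReprLaplaceFiveSumRigidK4eIdentsA
import Summits.ValiantsHypothesis.ValiantsHypothesis.Theorems.RigidityForcesSymmetryRankRigidMinimalReprLaplaceFiveSumRigidK4eEndgame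
import Summits.ValiantsHypothesis.ValiantsHypothesis.Theorems.RigidityForcesSymmetryRankRigidMinimalReprLaplaceFiveRelabel

/-!
# ValiantsHypothesis / RigidityForcesSymmetry — crux `LaplaceOptimalFive` (stmt-ValiantsHypothesis-24813), crux idea
`young-shadow` (K1): **K1 HOLDS ON the support `K₄ − e = {01, 02, 03, 12, 13}`** (composition) and on every placement of it

A side-symmetric pair decomposition of `P₅ = [v injective]` all of whose splits lie in this SUM-RIGID family has at least ten terms,
hence Laplace weight `≥ 120 = 5!`; by ✓ `LaplaceFiveRelabel.weight_ge_of_relabel` the same holds for every slot-relabelled copy of the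
family, and (K1 descends to sub-supports) for every sub-family.  Composition of the certificates ✓ `LaplaceFiveSumRigidK4e.ident11111 / ident2111 /
ident221` with ✓ `LaplaceFiveSumRigidK4e.endgame` — the kernel form of §12 of `NOTE-g7-24813-star-closed-rays.md` (val-idea-19 g7; refereed
val-idea-crit-3 g5).  Generated file (`gen/sumrigid3.py`, val-lit-p4 g15).

Honest framing.  K1 `SideSymLaplaceOptimalFive` in general (the 19 HARD families, among them the star and `K₃ ⊔ K₂`), S2′,
`LaplaceOptimalFive` (OPEN · CONTESTED 72/120), `RankRigidMinimalRepr`, `VP ≠ VNP` are NOT proved.  No definitions, no `sorry`.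
-/

set_option linter.dupNamespace false

namespace Summit.ValiantsHypothesis.ValiantsHypothesis.Theorems.RigidityForcesSymmetryRankRigidMinimalRepr

namespace LaplaceFiveSumRigidK4e

open Finset LaplaceFiveSectorSplit

variable {N : ℕ}

/-- **K1 on the canonical placement, term count.** [folklore] -/
theorem sideSym_K4ecanon_ten_le (T : Finset (Fin N)) (S : Fin N → Finset (Fin 5)) (u w : Fin N → (Fin 5 → Fin 5) → ℂ)
    (hdec : IsSplitDecomposition T S u w) (hsym : SideSymmetric T S u w)
    (hC : ∀ t ∈ T, S t = {0, 1} ∨ S t = {0, 2} ∨ S t = {0, 3} ∨ S t = {1, 2} ∨ S t = {1, 3}) : 10 ≤ T.card :=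
  endgame T S u w hdec hsym hC
    (fun a b c d e h => ident11111 T S u w hdec hsym hC a b c d e h)
    (fun a b c d h => ident2111 T S u w hdec hsym hC a b c d h)
    (fun a b c h => ident221 T S u w hdec hsym hC a b c h)

/-- **K1 on the canonical placement, Laplace weight `≥ 5!`.** [folklore] -/
theorem sideSym_K4ecanon (T : Finset (Fin N)) (S : Fin N → Finset (Fin 5)) (u w : Fin N → (Fin 5 → Fin 5) → ℂ)
    (hdec : IsSplitDecomposition T S u w) (hsym : SideSymmetric T S u w)
    (hC : ∀ t ∈ T, S t = {0, 1} ∨ S t = {0, 2} ∨ S t = {0, 3} ∨ S t = {1, 2} ∨ S t = {1, 3}) :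
    Nat.factorial 5 ≤ laplaceWeight T S := by
  classical
  have hten := sideSym_K4ecanon_ten_le T S u w hdec hsym hC
  have hcard : ∀ t ∈ T, (S t).card = 2 := by
    intro t ht
    rcases hC t ht with h | h | h | h | h <;> rw [h] <;> decide
  have hw12 : ∀ t ∈ T, (S t).card.factorial * (5 - (S t).card).factorial = 12 := by
    intro t ht
    rw [hcard t ht]
    decide
  unfold laplaceWeight
  rw [Finset.sum_congr rfl hw12, Finset.sum_const, smul_eq_mul]
  have : Nat.factorial 5 = 120 := by decide
  omega

/-- **K1 on every placement of the family**: splits `{π p, π q}` for the family's pairs `{p,q}`, `π` any slot permutation. [folklore] -/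
theorem sideSym_K4e (T : Finset (Fin N)) (S : Fin N → Finset (Fin 5)) (u w : Fin N → (Fin 5 → Fin 5) → ℂ)
    (hdec : IsSplitDecomposition T S u w) (hsym : SideSymmetric T S u w) (π : Equiv.Perm (Fin 5))
    (hC : ∀ t ∈ T, S t = {π 0, π 1} ∨ S t = {π 0, π 2} ∨ S t = {π 0, π 3} ∨ S t = {π 1, π 2} ∨ S t = {π 1, π 3}) :
    Nat.factorial 5 ≤ laplaceWeight T S := by
  classical
  refine LaplaceFiveRelabel.weight_ge_of_relabel ({{0, 1}, {0, 2}, {0, 3}, {1, 2}, {1, 3}} : Finset (Finset (Fin 5))) ?_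
    T S u w hdec hsym π⁻¹ ?_
  · intro N' T' S' u' w' hdec' hsym' hF
    refine sideSym_K4ecanon T' S' u' w' hdec' hsym' fun t ht => ?_
    have h := hF t ht
    simp only [Finset.mem_insert, Finset.mem_singleton] at h
    exact h
  · intro t ht
    have hinv : ∀ i : Fin 5, π⁻¹ (π i) = i := fun i => π.symm_apply_apply i
    rcases hC t ht with h | h | h | h | h <;> rw [h, LaplaceFiveRelabel.image_pair, hinv, hinv] <;> simp

end LaplaceFiveSumRigidK4e

end Summit.ValiantsHypothesis.ValiantsHypothesis.Theorems.RigidityForcesSymmetryRankRigidMinimalRepr
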